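import Mathlib
import Summits.NavierStokesRegularity.NavierStokesRegularity.Theorems.LevelSetModerationHighSpeedPressureWorkLinearLevelRecursion
import Summits.NavierStokesRegularity.NavierStokesRegularity.Theorems.LevelSetModerationHighSpeedPressureWorkOccupationQuantum
import Summits.NavierStokesRegularity.NavierStokesRegularity.Theorems.LevelSetModerationHighSpeedPressureWorkEarlyWindow
import Summits.NavierStokesRegularity.NavierStokesRegularity.Theorems.LevelSetModerationHighSpeedPressureWorkSliceMeasurability
import Summits.NavierStokesRegularity.NavierStokesRegularity.Theorems.LevelSetModerationHighSpeedPressureWorkConsequences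

/-!
# Route LevelSetModeration — crux 2 `HighSpeedPressureWork`: two stubs of line `iso-speed-area-closure`

Proof file for item stmt-NavierStokesRegularity-18149 (`HighSpeedPressureWork`), line
`iso-speed-area-closure` (crux-plan, 4 registered stubs). The two ANALYTIC stubs of the line are
proved here from the landed lemmas of this seat:

* `stub_linearLevelRecursion` — the linear dyadic level recursion in the line's exact shape
  (`toReal` form + finiteness of the iso-speed area `𝒟¹_c(T)`): the ENNReal recursion
  `levelSetModeration_linearLevelRecursion`, plus `𝒟¹_c(T) ≤ V_c(T) + D_c(T) < ∞` (pointwise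
  `a ≤ 1 + a²`; `levelSetVolume_le`, `levelSetDissipation_ne_top`, time-measurability of the
  dissipation slice `levelSetModeration_aemeasurable_dissipationSlice`);
* `stub_occupationQuantum` — the occupation quantum in the line's exact shape (threshold `A₀ B₀ ≤ G`
  and a near-max point anywhere on `[0, T']`): the cell lemma `levelSetModeration_occupationQuantum`
  plus the early window `levelSetModeration_earlyWindow` (a point of speed `> 3G/4 > 2B₀` cannot lie
  before `c₀ν/B₀² ≥ 4ν/G²` when `G ≥ (2/√c₀) B₀`) and time continuity to move the point off `T'`.

What remains of the line: `stub_isoSpeedAreaLaw` (the OPEN load, ⟸ crux by Cauchy–Schwarz) and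
`stub_boundedPairingBookkeeping` (L3).
-/

noncomputable section

-- single-conjunct summit: `Summit.<Summit>.<Problem>` repeats the name by the D-0017 layout
set_option linter.dupNamespace false

namespace Summit.NavierStokesRegularity.NavierStokesRegularity.Theorems

open MeasureTheory Set Filter Topology Function Metric
open scoped ENNReal NNReal
open Literature.Analysis.FluidPDE

/-! ### Finiteness of the iso-speed area -/

/-- **The total iso-speed area above a positive level is finite**: for a classical Leray–Hopf member
of the class and `c > 0`, `∫₀ᵀ ∫ 1_{|u|>c} ‖∇|u|‖ ≤ V_c(T) + D_c(T) < ∞` (pointwise `a ≤ 1 + a²`;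
Chebyshev bounds the occupation, the energy inequality bounds the level-set dissipation).
[folklore] -/
theorem levelSetModeration_isoSpeedArea_ne_top {ν T : ℝ}
    {u : ℝ → EuclideanSpace ℝ (Fin 3) → EuclideanSpace ℝ (Fin 3)}
    {p : ℝ → EuclideanSpace ℝ (Fin 3) → ℝ} (hν : 0 < ν) (hT : 0 < T)
    (hcl : IsClassicalNSSolutionOn (Ico 0 T) ν 0 u p) (hLH : IsLerayHopfOn T ν 0 (u 0) u)
    {c : ℝ} (hc : 0 < c) :
    (∫⁻ τ in Ioo 0 T, ∫⁻ x, {x | c < ‖u τ x‖}.indicator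
        (fun x => ENNReal.ofReal ‖fderiv ℝ (fun y => ‖u τ y‖) x‖) x) ≠ ⊤ := by
  set V : ℝ → ℝ≥0∞ := fun τ => volume {x | c < ‖u τ x‖} with hV
  set D : ℝ → ℝ≥0∞ := fun τ => ∫⁻ x, {x | c < ‖u τ x‖}.indicator
    (fun x => ENNReal.ofReal (‖fderiv ℝ (fun y => ‖u τ y‖) x‖ ^ 2)) x with hD
  -- pointwise in `τ`: area slice ≤ volume slice + dissipation slice
  have hslice : ∀ τ ∈ Ioo 0 T, (∫⁻ x, {x | c < ‖u τ x‖}.indicator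
      (fun x => ENNReal.ofReal ‖fderiv ℝ (fun y => ‖u τ y‖) x‖) x) ≤ V τ + D τ := by
    intro τ hτ
    have hτ' : τ ∈ Ico 0 T := ⟨hτ.1.le, hτ.2⟩
    have hA : MeasurableSet {x | c < ‖u τ x‖} :=
      (isOpen_lt continuous_const (hcl.contDiff_velocity hτ').continuous.norm).measurableSet
    have hpt : ∀ x, {x | c < ‖u τ x‖}.indicator
        (fun x => ENNReal.ofReal ‖fderiv ℝ (fun y => ‖u τ y‖) x‖) x ≤
        {x | c < ‖u τ x‖}.indicator (fun _ => (1 : ℝ≥0∞)) x +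
          {x | c < ‖u τ x‖}.indicator
            (fun x => ENNReal.ofReal (‖fderiv ℝ (fun y => ‖u τ y‖) x‖ ^ 2)) x := by
      intro x
      by_cases hx : x ∈ {x | c < ‖u τ x‖}
      · rw [indicator_of_mem hx, indicator_of_mem hx, indicator_of_mem hx]
        set a : ℝ := ‖fderiv ℝ (fun y => ‖u τ y‖) x‖
        have ha : a ≤ 1 + a ^ 2 := by nlinarith [sq_nonneg (a - 1)]
        calc ENNReal.ofReal a ≤ ENNReal.ofReal (1 + a ^ 2) := ENNReal.ofReal_le_ofReal ha
          _ = 1 + ENNReal.ofReal (a ^ 2) := by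
              rw [ENNReal.ofReal_add zero_le_one (sq_nonneg _), ENNReal.ofReal_one]
      · simp only [indicator_of_notMem hx, zero_add, le_refl]
    calc (∫⁻ x, {x | c < ‖u τ x‖}.indicator
          (fun x => ENNReal.ofReal ‖fderiv ℝ (fun y => ‖u τ y‖) x‖) x)
        ≤ ∫⁻ x, ({x | c < ‖u τ x‖}.indicator (fun _ => (1 : ℝ≥0∞)) x +
            {x | c < ‖u τ x‖}.indicator
              (fun x => ENNReal.ofReal (‖fderiv ℝ (fun y => ‖u τ y‖) x‖ ^ 2)) x) :=
          lintegral_mono hpt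
      _ = V τ + D τ := by
          rw [lintegral_add_left ((measurable_const).indicator hA), lintegral_indicator_const hA,
            one_mul]
  -- integrate in time and split
  have hDmeas : AEMeasurable D (volume.restrict (Ioo 0 T)) :=
    levelSetModeration_aemeasurable_dissipationSlice hcl.smooth_velocity hc le_rfl
  have hint : (∫⁻ τ in Ioo 0 T, ∫⁻ x, {x | c < ‖u τ x‖}.indicator
      (fun x => ENNReal.ofReal ‖fderiv ℝ (fun y => ‖u τ y‖) x‖) x) ≤
      (∫⁻ τ in Ioo 0 T, V τ) + ∫⁻ τ in Ioo 0 T, D τ := by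
    rw [← lintegral_add_right' _ hDmeas]
    exact setLIntegral_mono' measurableSet_Ioo fun τ hτ => hslice τ hτ
  have hVfin : (∫⁻ τ in Ioo 0 T, V τ) ≠ ⊤ :=
    ne_top_of_le_ne_top ENNReal.ofReal_ne_top (levelSetVolume_le hLH hν.le hT.le hc)
  have hDfin : (∫⁻ τ in Ioo 0 T, D τ) ≠ ⊤ := (levelSetDissipation_ne_top hcl hLH hT hν.le hc.le).1
  exact ne_top_of_le_ne_top (ENNReal.add_ne_top.2 ⟨hVfin, hDfin⟩) hint

/-! ### Stub `stub_linearLevelRecursion` of line `iso-speed-area-closure` -/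

/-- **STUB `stub_linearLevelRecursion` of line `iso-speed-area-closure` (PROVED).** The linear dyadic
level recursion in the line's shape: finiteness of the iso-speed area `𝒟¹_c(T)` and
`V_{2c}(T) ≤ C E₀^{1/3} c^{-5/3} 𝒟¹_c(T)` in real numbers (`levelSetModeration_linearLevelRecursion`
+ `levelSetModeration_isoSpeedArea_ne_top`). [folklore] -/
theorem stub_linearLevelRecursion : ∃ C : ℝ, 0 < C ∧ ∀ (ν T : ℝ) (u : ℝ → EuclideanSpace ℝ (Fin 3) → EuclideanSpace ℝ (Fin 3)) (p : ℝ → EuclideanSpace ℝ (Fin 3) → ℝ), 0 < ν → 0 < T → Literature.Analysis.FluidPDE.IsClassicalNSSolutionOn (Set.Ico 0 T) ν 0 u p → Literature.Analysis.FluidPDE.IsLerayHopfOn T ν 0 (u 0) u → Literature.Analysis.FluidPDE.HasRapidSpatialDecay (u 0) → ∀ (E₀ c : ℝ), (∫ x, ‖u 0 x‖ ^ 2) ≤ E₀ → 0 < c → (∫⁻ τ in Set.Ioo 0 T, ∫⁻ x, Set.indicator {x | c < ‖u τ x‖} (fun x => ENNReal.ofReal ‖fderiv ℝ (fun y => ‖u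 τ y‖) x‖) x) ≠ ⊤ ∧ (∫⁻ τ in Set.Ioo 0 T, volume {x | 2 * c < ‖u τ x‖}).toReal ≤ C * E₀ ^ (1 / 3 : ℝ) * c ^ (-(5 / 3 : ℝ)) * (∫⁻ τ in Set.Ioo 0 T, ∫⁻ x, Set.indicator {x | c < ‖u τ x‖} (fun x => ENNReal.ofReal ‖fderiv ℝ (fun y => ‖u τ y‖) x‖) x).toReal := by
  obtain ⟨C, hC, h⟩ := levelSetModeration_linearLevelRecursion
  refine ⟨C, hC, ?_⟩
  intro ν T u p hν hT hcl hLH hdec E₀ c hE₀ hc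
  have hfin := levelSetModeration_isoSpeedArea_ne_top hν hT hcl hLH hc
  refine ⟨hfin, ?_⟩
  have hE₀0 : 0 ≤ E₀ := le_trans (integral_nonneg fun _ => sq_nonneg _) hE₀
  have hK0 : 0 ≤ C * E₀ ^ (1 / 3 : ℝ) * c ^ (-(5 / 3 : ℝ)) := by positivity
  have hmain := h ν T u p hν hT hcl hLH hdec E₀ c hE₀ hc
  have hexp : C * E₀ ^ ((1 : ℝ) / 3) * c ^ (-(5 : ℝ) / 3) = C * E₀ ^ (1 / 3 : ℝ) * c ^ (-(5 / 3 : ℝ)) := by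
    norm_num
  rw [hexp] at hmain
  have hrhs : ENNReal.ofReal (C * E₀ ^ (1 / 3 : ℝ) * c ^ (-(5 / 3 : ℝ))) *
      (∫⁻ τ in Ioo 0 T, ∫⁻ x, {x | c < ‖u τ x‖}.indicator
        (fun x => ENNReal.ofReal ‖fderiv ℝ (fun y => ‖u τ y‖) x‖) x) ≠ ⊤ :=
    ENNReal.mul_ne_top ENNReal.ofReal_ne_top hfin
  have h1 := ENNReal.toReal_mono hrhs hmain
  rwa [ENNReal.toReal_mul, ENNReal.toReal_ofReal hK0] at h1

/-! ### Stub `stub_occupationQuantum` of line `iso-speed-area-closure` -/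

/-- **STUB `stub_occupationQuantum` of line `iso-speed-area-closure` (PROVED).** With the absolute
constants `κ` of `levelSetModeration_occupationQuantum` and `A₀ = max 4 (2/√c₀)` (`c₀` of the early
window): a member of the class bounded by `G ≥ A₀ B₀` on `[0, T']` that exceeds `3G/4` somewhere on
`[0, T'] × ℝ³` occupies at least `κ ν⁴/G⁵` of space–time above level `G/2` (the early window places
the near-max time after `c₀ν/B₀² ≥ 4ν/G²`; time continuity moves it strictly before `T'`; then the
cell lemma). [folklore] -/
theorem stub_occupationQuantum : ∃ κ A₀ : ℝ, 0 < κ ∧ 0 < A₀ ∧ ∀ (ν T : ℝ) (u : ℝ → EuclideanSpace ℝ (Fin 3) → EuclideanSpace ℝ (Fin 3)) (p : ℝ → EuclideanSpace ℝ (Fin 3) → ℝ), 0 < ν → 0 < T → Literature.Analysis.FluidPDE.IsClassicalNSSolutionOn (Set.Ico 0 T) ν 0 u p → Literature.Analysis.FluidPDE.IsLerayHopfOn T ν 0 (u 0) u → Literature.Analysis.FluidPDE.HasRapidSpatialDecay (u 0) → ∀ (B₀ : ℝ), 0 < B₀ → (∀ x, ‖u 0 x‖ ≤ B₀) → ∀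 (T' G : ℝ), T' < T → A₀ * B₀ ≤ G → (∀ t ∈ Set.Icc 0 T', ∀ x, ‖u t x‖ ≤ G) → (∃ t ∈ Set.Icc 0 T', ∃ x, 3 / 4 * G < ‖u t x‖) → κ * ν ^ 4 / G ^ 5 ≤ (∫⁻ τ in Set.Ioo 0 T, volume {x | G / 2 < ‖u τ x‖}).toReal := by
  obtain ⟨κ, hκ, hQ⟩ := levelSetModeration_occupationQuantum
  obtain ⟨c₀, hc₀, hW⟩ := levelSetModeration_earlyWindow
  set A₀ : ℝ := max 4 (2 / Real.sqrt c₀) with hA₀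
  have hA₀4 : (4 : ℝ) ≤ A₀ := le_max_left _ _
  have hA₀c : 2 / Real.sqrt c₀ ≤ A₀ := le_max_right _ _
  refine ⟨κ, A₀, hκ, by positivity, ?_⟩
  intro ν T u p hν hT hcl hLH hdec B₀ hB₀ hbd0 T' G hT'T hAG hbd hex
  obtain ⟨t₂, ht₂, x₂, hsp₂⟩ := hex
  have hG4 : 4 * B₀ ≤ G := le_trans (by nlinarith) hAG
  have hGpos : 0 < G := by linarith
  have hG2 : 0 < G ^ 2 := by positivity
  -- the early window places `t₂` after `c₀ ν / B₀²`
  have ht₂T : t₂ ∈ Ico 0 T := ⟨ht₂.1, ht₂.2.trans_lt hT'T⟩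
  have ht₂late : c₀ * ν / B₀ ^ 2 ≤ t₂ := by
    by_contra hlt
    rw [not_le] at hlt
    have h := (hW ν T u p hν hT hcl hLH hdec B₀ hB₀ hbd0 t₂ ht₂T hlt).1 x₂
    linarith
  -- `c₀ ν / B₀² ≥ 4 ν / G²` since `G ≥ (2/√c₀) B₀`
  have hsqrt : 0 < Real.sqrt c₀ := Real.sqrt_pos.2 hc₀
  have hGB : 2 * B₀ ≤ Real.sqrt c₀ * G := by
    have h1 : 2 / Real.sqrt c₀ * B₀ ≤ G := le_trans (mul_le_mul_of_nonneg_right hA₀c hB₀.le) hAG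
    rw [div_mul_eq_mul_div, div_le_iff₀ hsqrt] at h1
    linarith
  have hwin : 4 * ν / G ^ 2 ≤ c₀ * ν / B₀ ^ 2 := by
    -- `4 B₀² ≤ c₀ G²`
    have h1 : 4 * B₀ ^ 2 ≤ c₀ * G ^ 2 := by
      have := mul_self_le_mul_self (by positivity) hGB
      have hc : Real.sqrt c₀ * Real.sqrt c₀ = c₀ := Real.mul_self_sqrt hc₀.le
      nlinarith
    rw [div_le_div_iff₀ hG2 (by positivity)]
    nlinarith
  have ht₂4 : 4 * ν / G ^ 2 ≤ t₂ := hwin.trans ht₂late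
  have h34 : 3 * ν / G ^ 2 < 4 * ν / G ^ 2 := div_lt_div_of_pos_right (by linarith) hG2
  have hνG : 0 < ν / G ^ 2 := by positivity
  have ht₂pos : 0 < t₂ := lt_of_lt_of_le (by positivity) ht₂4
  have hT'pos : 0 < T' := ht₂pos.trans_le ht₂.2
  -- a near-max time strictly before `T'` and after `3ν/G²`
  have hspeed' : 3 * G / 4 < ‖u t₂ x₂‖ := by linarith
  obtain ⟨t₁, ht₁3, ht₁T', hsp₁⟩ : ∃ t₁, 3 * ν / G ^ 2 ≤ t₁ ∧ t₁ < T' ∧ 3 * G / 4 ≤ ‖u t₁ x₂‖ := by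
    rcases lt_or_eq_of_le ht₂.2 with hlt | heq
    · exact ⟨t₂, by linarith [h34], hlt, hspeed'.le⟩
    · -- `t₂ = T'`: move slightly to the left by time continuity within `[0, T)`
      have hcont : ContinuousWithinAt (fun s => ‖u s x₂‖) (Ico 0 T) t₂ :=
        (hcl.smooth_velocity.continuousWithinAt_time ht₂T x₂).norm
      set ℓ : ℝ := 3 * ν / G ^ 2 with hℓ
      have hℓt₂ : ℓ < t₂ := by rw [hℓ]; linarith [h34]
      have hsub : Ioo ℓ t₂ ⊆ Ico 0 T := fun s hs =>
        ⟨(lt_trans (by positivity) hs.1).le, hs.2.trans ht₂T.2⟩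
      have hcont' : ContinuousWithinAt (fun s => ‖u s x₂‖) (Ioo ℓ t₂) t₂ := hcont.mono hsub
      have hev : ∀ᶠ s in 𝓝[Ioo ℓ t₂] t₂, 3 * G / 4 < ‖u s x₂‖ :=
        hcont'.tendsto.eventually_const_lt hspeed'
      have hmem : ∀ᶠ s in 𝓝[Ioo ℓ t₂] t₂, s ∈ Ioo ℓ t₂ := self_mem_nhdsWithin
      rw [nhdsWithin_Ioo_eq_nhdsLT hℓt₂] at hev hmem
      obtain ⟨s, hs1, hs2⟩ := (hev.and hmem).exists
      exact ⟨s, hs2.1.le, heq ▸ hs2.2, hs1.le⟩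
  -- the cell lemma on `[0, T']`
  have hq := hQ ν T u p hν hT hcl hLH hdec T' G hT'pos hT'T hGpos hbd t₁ x₂ ht₁3 ht₁T' hsp₁
  have hmono : (∫⁻ τ in Ioo 0 T', volume {x | G / 2 < ‖u τ x‖}) ≤
      ∫⁻ τ in Ioo 0 T, volume {x | G / 2 < ‖u τ x‖} :=
    lintegral_mono_set (Ioo_subset_Ioo_right hT'T.le)
  have hfin : (∫⁻ τ in Ioo 0 T, volume {x | G / 2 < ‖u τ x‖}) ≠ ⊤ :=
    ne_top_of_le_ne_top ENNReal.ofReal_ne_top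
      (levelSetVolume_le hLH hν.le hT.le (by positivity : 0 < G / 2))
  exact (ENNReal.ofReal_le_iff_le_toReal hfin).1 (hq.trans hmono)

end Summit.NavierStokesRegularity.NavierStokesRegularity.Theorems

end
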